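import Mathlib.Probability.ProbabilityMassFunction.Monad
import HarnessLib

-- provenance: harness21/H21/H21/Prelude/CplxCore/DecisionTree.lean @ bc880d9 (interim HEAD d8f2665); M5 mechanical rewrite
/-!
# Decision trees and query complexity (trunk `CplxCore`, outline item C19)

This file realises the notion `decision_tree_complexity` of the H21 gap inventory.

A (deterministic, Boolean) *decision tree* on `n` input bits is a binary tree whose internal
nodes query one input coordinate `i : Fin n` and branch on the answer, and whose leaves are
labelled by an output bit. We define

* `Literature.CplxCore.DecisionTree n` : the inductive type of decision trees on `n` bits;
* `DecisionTree.eval`, `DecisionTree.depth`, `DecisionTree.cost` : the output on an input, the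
  depth (worst-case number of queries) and the number of queries made on a given input;
* `DecisionTree.comap g T` : reindex the queried coordinates along `g : Fin m → Fin n`
  (auxiliary, used to build the full tree of depth `n`);
* `DecisionTree.Computes f`, `DecisionTree.ComputesOn D f` : the tree computes the Boolean
  function `f` everywhere / on the domain `D` (partial functions, promise problems);
* `Literature.CplxCore.detQueryComplexity f` : the deterministic query complexity `D(f)`;
* `Literature.CplxCore.randQueryComplexity ε f` : the `ε`-error randomized query complexity `R_ε(f)`,
  where a randomized decision tree is a probability distribution (`PMF`) over deterministic
  trees; bounded-error `R(f)` is `randQueryComplexity (1/3) f` (no one-letter abbreviation is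
  introduced);
* the `…On D` variants for partial functions.

Mathlib has no decision-tree or query-complexity notion (searched `DecisionTree`, `query`);
we only use `PMF` (and `PMF.pure` for the embedding of deterministic into randomized trees,
whence the import of `Mathlib.Probability.ProbabilityMassFunction.Monad`, which re-exports
`…Basic`).

## References

* H. Buhrman, R. de Wolf, *Complexity measures and decision tree complexity: a survey*,
  Theoret. Comput. Sci. 288 (2002), §2–§3.
* N. Nisan, *CREW PRAMs and decision trees*, SIAM J. Comput. 20 (1991).

## Design choices

* All declarations live in `namespace Literature.CplxCore` (outline D7).
* Inputs are `Fin n → Bool` and outputs `Bool`, matching the survey; complexities are natural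
  numbers defined as `sInf` of the set of achievable depths (the set is nonempty for total
  functions since every function has a tree of depth `≤ n`, see
  `DecisionTree.exists_computes_depth_le` and `detQueryComplexity_set_nonempty`; for
  `randQueryComplexity` with `ε < 0` the set is empty and `sInf ∅ = 0` is a documented junk
  value).
* The success probability of a randomized tree `μ` on input `x` is measured with
  `PMF.toOuterMeasure`, which needs no measurable structure on `DecisionTree n`.
* Naming: the outline's `detQueryComplexity_le` is the bound `D(f) ≤ n`; the bound by the depth
  of a given tree is `detQueryComplexity_le_depth` (review r00166A, item 2).
* `DecisionTree n` derives `Inhabited` with default `leaf false`.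
-/

namespace Literature.Computability.Complexity

/-- A deterministic Boolean decision tree on `n` input bits: either a leaf labelled by the
output bit `b`, or an internal node querying coordinate `i` and continuing with `t₀` if the
answer is `false` and with `t₁` if it is `true`. The `Inhabited` default is `leaf false`.
(Buhrman–de Wolf 2002, §2.1.) [cite: Wolf2002, §2.1] -/
inductive DecisionTree (n : ℕ) : Type
  /-- A leaf outputting the bit `b`. -/
  | leaf (b : Bool) : DecisionTree n
  /-- Query coordinate `i`; go to `t₀` on answer `false`, to `t₁` on answer `true`. -/
  | query (i : Fin n) (t₀ t₁ : DecisionTree n) : DecisionTree n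
  deriving DecidableEq, Inhabited

namespace DecisionTree

variable {m n : ℕ}

/-- The output of the decision tree `T` on input `x : Fin n → Bool`.
(Buhrman–de Wolf 2002, §2.1.) [cite: Wolf2002, §2.1] -/
def eval (x : Fin n → Bool) : DecisionTree n → Bool
  | leaf b => b
  | query i t₀ t₁ => if x i then t₁.eval x else t₀.eval x

/-- The depth of a decision tree: the largest number of queries made on any root-to-leaf path
(a leaf has depth `0`). (Buhrman–de Wolf 2002, §2.1.) [cite: Wolf2002, §2.1] -/
def depth : DecisionTree n → ℕ
  | leaf _ => 0
  | query _ t₀ t₁ => max t₀.depth t₁.depth + 1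

/-- The number of queries the decision tree `T` makes on the input `x` (length of the path
followed by `x`). (Buhrman–de Wolf 2002, §2.1.) [cite: Wolf2002, §2.1] -/
def cost (x : Fin n → Bool) : DecisionTree n → ℕ
  | leaf _ => 0
  | query i t₀ t₁ => (if x i then t₁.cost x else t₀.cost x) + 1

/-- Reindex a decision tree along `g : Fin m → Fin n`: every query of coordinate `i` becomes a
query of coordinate `g i`. Auxiliary construction (restriction of a function to a subcube,
Buhrman–de Wolf 2002, §2.1). [cite: Wolf2002, §2.1] -/
def comap (g : Fin m → Fin n) : DecisionTree m → DecisionTree n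
  | leaf b => leaf b
  | query i t₀ t₁ => query (g i) (t₀.comap g) (t₁.comap g)

/-- A leaf outputs its label. (Buhrman–de Wolf 2002, §2.1.) [cite: Wolf2002, §2.1] -/
@[simp] theorem eval_leaf (x : Fin n → Bool) (b : Bool) : (leaf b : DecisionTree n).eval x = b :=
  rfl

/-- A query node branches on the queried bit. (Buhrman–de Wolf 2002, §2.1.) [cite: Wolf2002, §2.1] -/
@[simp] theorem eval_query (x : Fin n → Bool) (i : Fin n) (t₀ t₁ : DecisionTree n) :
    (query i t₀ t₁).eval x = if x i then t₁.eval x else t₀.eval x :=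
  rfl

/-- A leaf has depth `0`. (Buhrman–de Wolf 2002, §2.1.) [cite: Wolf2002, §2.1] -/
@[simp] theorem depth_leaf (b : Bool) : (leaf b : DecisionTree n).depth = 0 := rfl

/-- Depth of a query node. (Buhrman–de Wolf 2002, §2.1.) [cite: Wolf2002, §2.1] -/
@[simp] theorem depth_query (i : Fin n) (t₀ t₁ : DecisionTree n) :
    (query i t₀ t₁).depth = max t₀.depth t₁.depth + 1 :=
  rfl

/-- A leaf makes no queries. (Buhrman–de Wolf 2002, §2.1.) [cite: Wolf2002, §2.1] -/
@[simp] theorem cost_leaf (x : Fin n → Bool) (b : Bool) : (leaf b : DecisionTree n).cost x = 0 :=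
  rfl

/-- Cost of a query node on input `x`: one query plus the cost of the branch taken.
(Buhrman–de Wolf 2002, §2.1.) [cite: Wolf2002, §2.1] -/
@[simp] theorem cost_query (x : Fin n → Bool) (i : Fin n) (t₀ t₁ : DecisionTree n) :
    (query i t₀ t₁).cost x = (if x i then t₁.cost x else t₀.cost x) + 1 :=
  rfl

/-- Evaluating a reindexed tree is evaluating the original tree on the pulled-back input.
(Buhrman–de Wolf 2002, §2.1.) [cite: Wolf2002, §2.1] -/
@[simp] theorem eval_comap (g : Fin m → Fin n) (T : DecisionTree m) (x : Fin n → Bool) :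
    (T.comap g).eval x = T.eval (x ∘ g) := by
  induction T with
  | leaf b => rfl
  | query i t₀ t₁ ih₀ ih₁ => simp [comap, ih₀, ih₁]

/-- Reindexing preserves depth. (Buhrman–de Wolf 2002, §2.1.) [cite: Wolf2002, §2.1] -/
@[simp] theorem depth_comap (g : Fin m → Fin n) (T : DecisionTree m) :
    (T.comap g).depth = T.depth := by
  induction T with
  | leaf b => rfl
  | query i t₀ t₁ ih₀ ih₁ => simp [comap, ih₀, ih₁]

/-- On every input, the number of queries made is at most the depth of the tree.
(Buhrman–de Wolf 2002, §2.1.) [cite: Wolf2002, §2.1] -/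
theorem cost_le_depth (T : DecisionTree n) (x : Fin n → Bool) : T.cost x ≤ T.depth := by
  induction T with
  | leaf b => simp
  | query i t₀ t₁ ih₀ ih₁ =>
    simp only [cost_query, depth_query, Nat.add_le_add_iff_right]
    split <;> omega

/-- The decision tree `T` computes the total Boolean function `f`: `T.eval x = f x` for every
input `x`. (Buhrman–de Wolf 2002, §2.1.) [cite: Wolf2002, §2.1] -/
def Computes (T : DecisionTree n) (f : (Fin n → Bool) → Bool) : Prop :=
  ∀ x, T.eval x = f x

/-- The decision tree `T` computes `f` on the domain (promise) `D ⊆ {0,1}ⁿ`: `T.eval x = f x`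
for every `x ∈ D`. (Buhrman–de Wolf 2002, §2.1, partial functions.) [cite: Wolf2002, §2.1  partial functions] -/
def ComputesOn (T : DecisionTree n) (D : Set (Fin n → Bool)) (f : (Fin n → Bool) → Bool) :
    Prop :=
  ∀ x ∈ D, T.eval x = f x

/-- Computing a total function is computing it on the full domain.
(Buhrman–de Wolf 2002, §2.1.) [cite: Wolf2002, §2.1] -/
theorem computes_iff_computesOn_univ (T : DecisionTree n) (f : (Fin n → Bool) → Bool) :
    T.Computes f ↔ T.ComputesOn Set.univ f := by
  simp [Computes, ComputesOn]

/-- A tree computing `f` everywhere computes it on any domain. (Buhrman–de Wolf 2002, §2.1.) [cite: Wolf2002, §2.1] -/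
theorem Computes.computesOn {T : DecisionTree n} {f : (Fin n → Bool) → Bool} (h : T.Computes f)
    (D : Set (Fin n → Bool)) : T.ComputesOn D f :=
  fun x _ => h x

/-- `ComputesOn` is antitone in the domain. (Buhrman–de Wolf 2002, §2.1.) [cite: Wolf2002, §2.1] -/
theorem ComputesOn.mono {T : DecisionTree n} {D D' : Set (Fin n → Bool)}
    {f : (Fin n → Bool) → Bool} (h : T.ComputesOn D f) (hD : D' ⊆ D) : T.ComputesOn D' f :=
  fun x hx => h x (hD hx)

/-- Every total Boolean function on `n` bits is computed by some decision tree of depth at most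
`n` (query all variables in turn). (Buhrman–de Wolf 2002, §2.1: `D(f) ≤ n`.) [cite: Wolf2002, §2.1:  D(f] -/
theorem exists_computes_depth_le (f : (Fin n → Bool) → Bool) :
    ∃ T : DecisionTree n, T.Computes f ∧ T.depth ≤ n := by
  induction n with
  | zero => exact ⟨leaf (f Fin.elim0), fun x => congrArg f (Subsingleton.elim _ _), le_rfl⟩
  | succ n ih =>
    obtain ⟨T₀, hT₀, hd₀⟩ := ih (fun y => f (Fin.cons false y))
    obtain ⟨T₁, hT₁, hd₁⟩ := ih (fun y => f (Fin.cons true y))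
    refine ⟨query 0 (T₀.comap Fin.succ) (T₁.comap Fin.succ), fun x => ?_, ?_⟩
    · have hx : ∀ b, x 0 = b → Fin.cons b (x ∘ Fin.succ) = x := by
        rintro b rfl
        exact Fin.cons_self_tail x
      cases h : x 0
      · simpa [h, Computes] using (hT₀ (x ∘ Fin.succ)).trans (congrArg f (hx false h))
      · simpa [h, Computes] using (hT₁ (x ∘ Fin.succ)).trans (congrArg f (hx true h))
    · simp only [depth_query, depth_comap]
      omega

end DecisionTree

variable {n : ℕ}

/-- The deterministic query complexity `D(f)` of a total Boolean function `f : {0,1}ⁿ → {0,1}`: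
the least depth of a decision tree computing `f`. The defining set is nonempty by
`detQueryComplexity_set_nonempty`. (Buhrman–de Wolf 2002, Definition in §2.1.) [cite: Wolf2002, Definition in §2.1] -/
noncomputable def detQueryComplexity (f : (Fin n → Bool) → Bool) : ℕ :=
  sInf {d | ∃ T : DecisionTree n, T.depth = d ∧ T.Computes f}

/-- The deterministic query complexity of the partial Boolean function `f` with domain `D`:
the least depth of a decision tree agreeing with `f` on `D`.
(Buhrman–de Wolf 2002, §2.1.) [cite: Wolf2002, §2.1] -/
noncomputable def detQueryComplexityOn (D : Set (Fin n → Bool)) (f : (Fin n → Bool) → Bool) :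
    ℕ :=
  sInf {d | ∃ T : DecisionTree n, T.depth = d ∧ T.ComputesOn D f}

/-- The `ε`-error randomized query complexity `R_ε(f)` of a total Boolean function `f`: the least
`d` such that some probability distribution `μ` over decision trees of depth `≤ d` outputs
`f x` with probability at least `1 - ε` on every input `x`. Bounded-error randomized query
complexity `R(f) = R_{1/3}(f)` is `randQueryComplexity (1/3) f`. If no such distribution exists
(i.e. `ε < 0`) the value is the junk value `sInf ∅ = 0`.
(Buhrman–de Wolf 2002, §2.2.) [cite: Wolf2002, §2.2] -/
noncomputable def randQueryComplexity (ε : ℝ) (f : (Fin n → Bool) → Bool) : ℕ :=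
  sInf {d | ∃ μ : PMF (DecisionTree n), (∀ T ∈ μ.support, T.depth ≤ d) ∧
    ∀ x, 1 - ε ≤ (μ.toOuterMeasure {T | T.eval x = f x}).toReal}

/-- The `ε`-error randomized query complexity of the partial Boolean function `f` with domain
`D`: as `randQueryComplexity`, but the success-probability requirement is only imposed on inputs
`x ∈ D`. (Buhrman–de Wolf 2002, §2.2.) [cite: Wolf2002, §2.2] -/
noncomputable def randQueryComplexityOn (ε : ℝ) (D : Set (Fin n → Bool))
    (f : (Fin n → Bool) → Bool) : ℕ :=
  sInf {d | ∃ μ : PMF (DecisionTree n), (∀ T ∈ μ.support, T.depth ≤ d) ∧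
    ∀ x ∈ D, 1 - ε ≤ (μ.toOuterMeasure {T | T.eval x = f x}).toReal}

/-- The set of depths of trees computing a total function `f` is nonempty.
(Buhrman–de Wolf 2002, §2.1.) [cite: Wolf2002, §2.1] -/
theorem detQueryComplexity_set_nonempty (f : (Fin n → Bool) → Bool) :
    {d | ∃ T : DecisionTree n, T.depth = d ∧ T.Computes f}.Nonempty := by
  obtain ⟨T, hT, -⟩ := DecisionTree.exists_computes_depth_le f
  exact ⟨T.depth, T, rfl, hT⟩

/-- `D(f)` is attained: some tree of depth exactly `detQueryComplexity f` computes `f`.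
(Buhrman–de Wolf 2002, §2.1.) [cite: Wolf2002, §2.1] -/
theorem exists_depth_eq_detQueryComplexity (f : (Fin n → Bool) → Bool) :
    ∃ T : DecisionTree n, T.depth = detQueryComplexity f ∧ T.Computes f :=
  Nat.sInf_mem (detQueryComplexity_set_nonempty f)

/-- Any decision tree computing `f` bounds the deterministic query complexity by its depth.
(Buhrman–de Wolf 2002, §2.1.) [cite: Wolf2002, §2.1] -/
theorem detQueryComplexity_le_depth {f : (Fin n → Bool) → Bool} (T : DecisionTree n)
    (hT : T.Computes f) : detQueryComplexity f ≤ T.depth :=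
  Nat.sInf_le ⟨T, rfl, hT⟩

/-- `D(f) ≤ n` for every total Boolean function on `n` bits. (Buhrman–de Wolf 2002, §2.1.) [cite: Wolf2002, §2.1] -/
theorem detQueryComplexity_le (f : (Fin n → Bool) → Bool) : detQueryComplexity f ≤ n := by
  obtain ⟨T, hT, hd⟩ := DecisionTree.exists_computes_depth_le f
  exact (detQueryComplexity_le_depth T hT).trans hd

/-- Any decision tree computing `f` on `D` bounds `detQueryComplexityOn D f` by its depth.
(Buhrman–de Wolf 2002, §2.1.) [cite: Wolf2002, §2.1] -/
theorem detQueryComplexityOn_le_depth {D : Set (Fin n → Bool)} {f : (Fin n → Bool) → Bool}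
    (T : DecisionTree n) (hT : T.ComputesOn D f) : detQueryComplexityOn D f ≤ T.depth :=
  Nat.sInf_le ⟨T, rfl, hT⟩

/-- The query complexity of a partial function is at most that of any total extension.
(Buhrman–de Wolf 2002, §2.1.) [cite: Wolf2002, §2.1] -/
theorem detQueryComplexityOn_le_detQueryComplexity (D : Set (Fin n → Bool))
    (f : (Fin n → Bool) → Bool) : detQueryComplexityOn D f ≤ detQueryComplexity f := by
  obtain ⟨T, hd, hT⟩ := exists_depth_eq_detQueryComplexity f
  exact hd ▸ detQueryComplexityOn_le_depth T (hT.computesOn D)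

/-- A deterministic tree of depth `d` computing `f` on `D`, viewed as the Dirac randomized tree
`PMF.pure T`, witnesses `randQueryComplexityOn ε D f ≤ d` for every `ε ≥ 0`.
(Buhrman–de Wolf 2002, §2.2.) [cite: Wolf2002, §2.2] -/
theorem randQueryComplexityOn_le_depth {ε : ℝ} (hε : 0 ≤ ε) {D : Set (Fin n → Bool)}
    {f : (Fin n → Bool) → Bool} (T : DecisionTree n) (hT : T.ComputesOn D f) :
    randQueryComplexityOn ε D f ≤ T.depth := by
  refine Nat.sInf_le ⟨PMF.pure T, fun T' hT' => ?_, fun x hx => ?_⟩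
  · rw [PMF.support_pure, Set.mem_singleton_iff] at hT'
    rw [hT']
  · have hmem : T ∈ {T' : DecisionTree n | T'.eval x = f x} := hT x hx
    rw [PMF.toOuterMeasure_pure_apply, if_pos hmem, ENNReal.toReal_one]
    linarith

/-- Randomized query complexity is at most deterministic query complexity, for every error
parameter `ε ≥ 0`: a deterministic tree is a (Dirac) randomized one with success probability `1`.
The hypothesis `0 ≤ ε` matches the informal statement (for `ε < 0` the inequality also holds,
but only through the junk value `randQueryComplexity ε f = sInf ∅ = 0`).
(Buhrman–de Wolf 2002, §2.2: `R_ε(f) ≤ D(f)`.) [cite: Wolf2002, §2.2:  R_ε(f] -/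
theorem randQueryComplexity_le_det {ε : ℝ} (hε : 0 ≤ ε) (f : (Fin n → Bool) → Bool) :
    randQueryComplexity ε f ≤ detQueryComplexity f := by
  obtain ⟨T, hd, hT⟩ := exists_depth_eq_detQueryComplexity f
  rw [← hd]
  refine Nat.sInf_le ⟨PMF.pure T, fun T' hT' => ?_, fun x => ?_⟩
  · rw [PMF.support_pure, Set.mem_singleton_iff] at hT'
    rw [hT']
  · have hmem : T ∈ {T' : DecisionTree n | T'.eval x = f x} := hT x
    rw [PMF.toOuterMeasure_pure_apply, if_pos hmem, ENNReal.toReal_one]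
    linarith

/-- The partial-function analogue of `randQueryComplexity_le_det` (same remark on `0 ≤ ε`).
(Buhrman–de Wolf 2002, §2.2.) [cite: Wolf2002, §2.2] -/
theorem randQueryComplexityOn_le_det {ε : ℝ} (hε : 0 ≤ ε) (D : Set (Fin n → Bool))
    (f : (Fin n → Bool) → Bool) :
    randQueryComplexityOn ε D f ≤ detQueryComplexityOn D f := by
  have hne : {d | ∃ T : DecisionTree n, T.depth = d ∧ T.ComputesOn D f}.Nonempty := by
    obtain ⟨T, hT, -⟩ := DecisionTree.exists_computes_depth_le f
    exact ⟨T.depth, T, rfl, hT.computesOn D⟩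
  obtain ⟨T, hd, hT⟩ := Nat.sInf_mem hne
  calc randQueryComplexityOn ε D f ≤ T.depth := randQueryComplexityOn_le_depth hε T hT
    _ = detQueryComplexityOn D f := hd

end Literature.Computability.Complexity
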